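import Literature.NumberTheory.EllipticCurves.InertiaInvariantsKodairaNeronMultiplicativeProofs
import Literature.NumberTheory.EllipticCurves.KodairaNeronMultiplicativeProofs
import Literature.NumberTheory.EllipticCurves.GaloisActionProofs
import HarnessLib

/-!
# Multiplicative reduction with `p ∤ v(Δ)`: the inertia group moves a `p`-torsion point
# (the Tate-curve form of "`ρ̄_{E,p}` is ramified at `ℓ`", from Kodaira–Néron)

`Proofs` file (theorems only, no definitions, no named facts) in topic
`NumberTheory/EllipticCurves`.  Throughout the `bsd` family (bsd.S21, S25, S30: Kato,
Skinner–Urban, Burungale–Skinner–Tian–Wan) the printed hypothesis "there is a prime `ℓ ‖ N` at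
which the mod-`p` representation `ρ̄_{E,p}` is ramified" is transcribed in *Tate-curve form*:
multiplicative reduction at `ℓ ≠ p` and `p ∤ v_ℓ(Δ_min)`.  The dictionary is the theory of the
Tate curve: over `K_ℓ^nr` one has `E[p] ≅ ⟨ζ_p, q^{1/p}⟩` with `v_ℓ(q) = v_ℓ(Δ_min)`, so the inertia
group acts trivially on `E[p]` iff `q` is a `p`-th power in `K_ℓ^nr`, iff `p ∣ v_ℓ(Δ_min)`
(Silverman, *ATAEC*, V.4–V.5 and Exercise 5.13(b), PDF p. 416 of the held copy: for split
multiplicative reduction over a local field the image of the inertia group in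
`Aut(T_p(E)) ≅ GL₂(ℤ_p)` is `{(1 b; 0 1) : ord_p(b) ≥ ord_p(v_K(j_E))}`, attributed there (notes,
PDF p. 441) to Serre, *Abelian ℓ-adic representations and elliptic curves* (1968), Ch. IV,
A.1.2).  This file proves the direction used by those transcriptions —

* `IsDedekindDomain.HeightOneSpectrum.exists_inertia_map_ne_of_multiplicative` — for an
  elliptic curve over the completion `K_v` of a number field given by an integral equation `X₀`
  with nodal reduction (`c₄ ∈ 𝓞_v^×`) and `Δ(X₀) = u π^n`, `u ∈ 𝓞_v^×`, `π` a uniformiser,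
  `n ≥ 1`, and a prime `p` with `v ∤ p` and `p ∤ n`: **some element of the inertia group
  `I_𝔐 ≤ Γ_{K_v}` moves some `p`-torsion point of `X₀(K̄_v)`** (the form over `ℚ`, reading the
  hypotheses `WeierstrassCurve.HasMultiplicativeReductionAtPrime ℓ` and
  `p ∤ v_ℓ(WeierstrassCurve.minimalDiscriminantInt)` of the `bsd` transcriptions on a globally
  minimal `W/ℚ`, is left to the consumer: `ℓ` is a uniformiser of `𝓞_v` and
  `Δ_min = ℓ^{v_ℓ(Δ_min)} · unit` there)

— **without the Tate curve**, from Kodaira–Néron over `K_v^nr` (Silverman, *ATAEC*,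
Cor. IV.9.2(d): for split multiplicative reduction over a henselian discrete valuation ring
`[E(K) : E₀(K)] = v(Δ)`, tree `LocalIndex.index_eq_of_tateNormalForm`,
`KodairaNeronSplitHenselianProofs`) and the structure of `E₀/E₁ ↪ \bar k^×` at a node
(Silverman, *AEC*, VII.2.1, III.2.5, VII.3.1; tree `exists_addMonoidHom_units_of_node`,
`ReducesToZero.eq_zero_of_zsmul_eq_zero`).

## Proof

Suppose every `σ ∈ I_𝔐` fixes every `P ∈ X(K̄_v)` with `pP = O`.  As in
`kodairaNeron_exists_finset_reducesToNonsingular_of_hasMultiplicativeReduction`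
(`KodairaNeronMultiplicativeProofs`): the coordinates of such `P` lie in `K_v^nr = (K̄_v)^{I_𝔐}`
(`mem_maxUnramified_iff_forall_inertia`), so `P` comes from a point `Q` of `J(K_v^nr)`,
`J = X₀ ⊗ 𝒪ⁿʳ`, and `pQ = O`.  Over the henselian discrete valuation ring `𝒪ⁿʳ` (unramified over
`𝓞_v`, so `Δ(J) = φ(u) φ(π)^n` with `φ(π)` a uniformiser) the node of `J` is split and `J` has a
Tate normal form `y² + xy = x³ + α ϖ^m` with `m = v(Δ(J)) = n`, whence `[J(K_v^nr) : E₀] = n`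
(`LocalIndex.index_eq_of_tateNormalForm`) and `nQ ∈ E₀`; as `pQ = O ∈ E₀` and `(n, p) = 1`,
`Q ∈ E₀`.  Hence the whole `p`-torsion `G = X(K̄_v)[p]` has nonsingular reduction on the
`𝒪_w`-model `W₀ = J ⊗ 𝒪_w`, whose reduction is a node; the node map `r : E₀ → \bar k^×`
(`exists_addMonoidHom_units_of_node`) has kernel `E₁`, which has no `p`-torsion
(`|p|_v = 1`, `ReducesToZero.eq_zero_of_zsmul_eq_zero`), so `r` embeds `G` into
`{ζ : ζ^p = 1}`, of size `≤ p` — against `#G = p²` (`card_torsionPoints_eq_sq_holds`).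

## References

* [SilvermanATAEC1994] J. H. Silverman, *Advanced Topics in the Arithmetic of Elliptic Curves*,
  GTM 151 (1994): Cor. IV.9.2(d) (PDF p. 340); V.4–V.5 (Tate curve); Exercise 5.13(b)
  (PDF p. 416) with its attribution (PDF p. 441).
* [SilvermanAEC2009] J. H. Silverman, *The Arithmetic of Elliptic Curves*, 2nd ed. (2009):
  VII.2.1, VII.3.1, III.2.5, Cor. III.6.4(b), proof of Thm. VII.7.1 (PDF pp. 166–179).
* [SerreAbelianLadic1968] J.-P. Serre, *Abelian `ℓ`-adic representations and elliptic curves*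
  (1968), Ch. IV, A.1.2 (the inertia group at a multiplicative place acts through `(1 *; 0 1)`;
  as quoted by Silverman, *ATAEC*, notes to Ex. 5.13, PDF p. 441).

## Design

No definitions; theorems only; `open scoped Classical NNReal`; one universe `u`; the spectral
valuation is quantified with `hw` as in `SelmerFiniteProofs` / `KodairaNeronMultiplicativeProofs`,
whose setting (`K_v`, `K̄_v`, `K_v^nr`, `𝒪ⁿʳ`, `𝓞_v` spelled out) and steps (1)–(4) are followed
verbatim.  `set_option maxHeartbeats` is raised for the main theorem (many coercions), as there.
-/

noncomputable section

open scoped Classical NNReal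
open NumberField IsDedekindDomain Field Polynomial IsLocalRing

universe u

namespace IsDedekindDomain.HeightOneSpectrum

open Literature.NumberTheory.EllipticCurves Literature.NumberTheory.EllipticCurves.LocalIndex
  Literature.NumberTheory.GaloisRepresentations
  Literature.NumberTheory.GaloisRepresentations.IsNonarchimedeanLocalField
  Literature.NumberTheory.DiophantineGeometry Literature.NumberTheory.DiophantineGeometry.TateAlgorithm

variable {K : Type u} [Field K] [NumberField K] {v : HeightOneSpectrum (𝓞 K)}
  {w : Valuation (AlgebraicClosure (v.adicCompletion K)) ℝ≥0}
  (hw : ∀ x, (w x : ℝ) = spectralNorm (v.adicCompletion K) (AlgebraicClosure (v.adicCompletion K)) x)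

include hw in
set_option maxHeartbeats 4000000 in
/-- **Multiplicative reduction with `p ∤ v(Δ)`: the inertia group moves a `p`-torsion point.**
Let `K` be a number field, `v` a finite place, `X₀` a Weierstrass equation over `𝓞_v` with
`c₄(X₀) ∈ 𝓞_v^×` and `Δ(X₀) = u π^n` (`u ∈ 𝓞_v^×`, `π` a uniformiser, `n ≥ 1`) — an integral
equation with multiplicative reduction and `v(Δ) = n` —, `p` a prime with `v ∤ p` and `p ∤ n`,
and `𝔐` the prime of `\bar 𝓞_v ⊆ K̄_v` above `𝓂_v` with inertia group `I_𝔐 ≤ Γ_{K_v}`.  Then some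
`σ ∈ I_𝔐` moves some point `P ∈ X₀(K̄_v)` with `pP = O`.  (Tate-curve dictionary: `ρ̄_{E,p}` is
ramified at a multiplicative place `v ∤ p` iff `p ∤ v(Δ_min)`, Silverman, *ATAEC*, Ex. 5.13(b);
proof here from Kodaira–Néron over `K_v^nr` and `E₀/E₁ ↪ \bar k^×`, module docstring.)
[cite: SilvermanATAEC1994, Cor. IV.9.2(d) (PDF p. 340) and Exercise 5.13(b) (PDF p. 416)]
[cite: SilvermanAEC2009, Prop. VII.2.1, Prop. VII.3.1, Prop. III.2.5, Cor. III.6.4(b)]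
[cite: SerreAbelianLadic1968, Ch. IV, A.1.2] -/
theorem exists_inertia_map_ne_of_multiplicative
    (X₀ : WeierstrassCurve (v.adicCompletionIntegers K)) {u π : v.adicCompletionIntegers K}
    (hu : IsUnit u) (hπ : Irreducible π) {n : ℕ} (hn : 1 ≤ n) (hΔ : X₀.Δ = u * π ^ n)
    (hc₄ : X₀.c₄ ∉ maximalIdeal (v.adicCompletionIntegers K))
    {p : ℕ} (hp : p.Prime) (hpv : (p : 𝓞 K) ∉ v.asIdeal) (hpn : ¬ p ∣ n)
    {𝔐 : Ideal v.localAbsIntegers} (h𝔐 : 𝔐 ∈ v.localPrimesAbove) :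
    ∃ σ ∈ 𝔐.inertia (absoluteGaloisGroup (v.adicCompletion K)),
      ∃ P : ((X₀.baseChange (v.adicCompletion K)).baseChange
          (AlgebraicClosure (v.adicCompletion K))).toAffine.Point,
        p • P = 0 ∧
          WeierstrassCurve.Affine.Point.map
            ((absoluteGaloisGroup.toAlgEquiv _ σ :
                (AlgebraicClosure (v.adicCompletion K)) ≃ₐ[(v.adicCompletion K)]
                  (AlgebraicClosure (v.adicCompletion K))) :
              (AlgebraicClosure (v.adicCompletion K)) →ₐ[(v.adicCompletion K)]
                (AlgebraicClosure (v.adicCompletion K))) P ≠ P := by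
  by_contra hall
  push Not at hall
  -- the setting, as in `KodairaNeronMultiplicativeProofs`
  set X : WeierstrassCurve (v.adicCompletion K) := X₀.baseChange (v.adicCompletion K) with hXdef
  letI instDec : DecidableEq (maxUnramified (v.adicCompletion K)) :=
    fun a b => Classical.propDecidable (a = b)
  haveI := isDiscreteValuationRing_unrIntegers hw
  haveI := henselianLocalRing_unrIntegers hw
  obtain ⟨φ, hφ⟩ := exists_ringHom_adicCompletionIntegers_unrIntegers hw
  obtain ⟨ψ, hψ⟩ := exists_ringHom_unrIntegers_integer (w := w) (v := v) (K := K)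
  have hvR := integers_valuationRing_valuation (Valuation.valuationSubring (Valuation.comap
    (algebraMap (maxUnramified (v.adicCompletion K)) (AlgebraicClosure (v.adicCompletion K))) w))
    (maxUnramified (v.adicCompletion K))
  have hinjR := IsFractionRing.injective (Valuation.valuationSubring (Valuation.comap
    (algebraMap (maxUnramified (v.adicCompletion K)) (AlgebraicClosure (v.adicCompletion K))) w))
    (maxUnramified (v.adicCompletion K))
  have hv0 : w.Integers w.integer := Valuation.integer.integers w
  have hinj0 : Function.Injective (algebraMap w.integer (AlgebraicClosure (v.adicCompletion K))) :=
    hv0.hom_inj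
  -- valuations of `p`
  have hpw : w ((p : ℤ) : AlgebraicClosure (v.adicCompletion K)) = 1 :=
    spectralValuation_intCast_eq_one hw (n := (p : ℤ)) (by simpa using hpv)
  have hpL : ((p : ℕ) : AlgebraicClosure (v.adicCompletion K)) ≠ 0 := by
    intro h0
    have : w ((p : ℤ) : AlgebraicClosure (v.adicCompletion K)) = 0 := by
      rw [Int.cast_natCast, h0, map_zero]
    rw [hpw] at this
    exact one_ne_zero this
  -- `X` is an elliptic curve: `Δ(X₀) = u π^n ≠ 0`
  have hπ0 : π ≠ 0 := hπ.ne_zero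
  have hΔ0 : X₀.Δ ≠ 0 := by
    rw [hΔ]; exact mul_ne_zero hu.ne_zero (pow_ne_zero _ hπ0)
  haveI hXell : X.IsElliptic := by
    refine ⟨isUnit_iff_ne_zero.mpr ?_⟩
    change (X₀.map (algebraMap _ _)).Δ ≠ 0
    rw [WeierstrassCurve.map_Δ]
    exact fun h ↦ hΔ0 (IsFractionRing.injective (v.adicCompletionIntegers K) (v.adicCompletion K)
      (by rw [h, map_zero]))
  -- multiplicative conditions on `X₀`, transferred to `J = X₀ ⊗ 𝒪ⁿʳ`
  have hπm : π ∈ maximalIdeal (v.adicCompletionIntegers K) :=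
    (IsLocalRing.mem_maximalIdeal _).mpr hπ.not_isUnit
  have hΔm : X₀.Δ ∈ maximalIdeal (v.adicCompletionIntegers K) := by
    rw [hΔ]
    obtain ⟨k, rfl⟩ : ∃ k, n = k + 1 := ⟨n - 1, by omega⟩
    rw [pow_succ, ← mul_assoc]
    exact Ideal.mul_mem_left _ _ hπm
  set J := X₀.map φ with hJdef
  have hΔI : J.Δ ∈ maximalIdeal (Valuation.valuationSubring (Valuation.comap (algebraMap
      (maxUnramified (v.adicCompletion K)) (AlgebraicClosure (v.adicCompletion K))) w)) := by
    rw [hJdef, WeierstrassCurve.map_Δ]; exact (map_mem_maximalIdeal_iff hw hφ _).mpr hΔm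
  have hc₄I : J.c₄ ∉ maximalIdeal (Valuation.valuationSubring (Valuation.comap (algebraMap
      (maxUnramified (v.adicCompletion K)) (AlgebraicClosure (v.adicCompletion K))) w)) := by
    rw [hJdef, WeierstrassCurve.map_c₄]; exact fun h ↦ hc₄ ((map_mem_maximalIdeal_iff hw hφ _).mp h)
  have hΔI0 : J.Δ ≠ 0 := by
    rw [hJdef, WeierstrassCurve.map_Δ]
    exact fun h0 ↦ hΔ0 (injective_of_coe_eq_algebraMap hφ (by rw [h0, map_zero]))
  -- (1) Tate normal form over the henselian `𝒪ⁿʳ`; its exponent is `n`; `[J(K_v^nr) : E₀] = n`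
  have hsplit := exists_splitNode_root_unrIntegers hw J hΔI hc₄I
  obtain ⟨D, h1, h2, h3, h4, h6⟩ := J.exists_variableChange_eq_tateNormalForm hΔI hc₄I hsplit
  set J' := D • J with hJ'
  have hJ'Δ : J'.Δ ≠ 0 := fun h0 ↦ by
    rw [hJ', WeierstrassCurve.variableChange_Δ, mul_eq_zero] at h0
    rcases h0 with h0 | h0
    · exact (D.u⁻¹ ^ 12).isUnit.ne_zero (by simpa only [Units.val_pow_eq_pow_val] using h0)
    · exact hΔI0 h0
  have ha0 : J'.a₆ ≠ 0 := fun h0 ↦ by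
    apply hJ'Δ
    rw [J'.Δ_eq_of_tateNormalForm h1 h2 h3 h4, h0, zero_mul, neg_zero]
  have hϖ' : Irreducible (φ π) := irreducible_map_of_coe_eq_algebraMap hw hφ hπ
  obtain ⟨m, α, hα⟩ := IsDiscreteValuationRing.eq_unit_mul_pow_irreducible ha0 hϖ'
  have hm1 : 1 ≤ m := by
    rcases Nat.eq_zero_or_pos m with h0 | hpos
    · exfalso
      rw [h0, pow_zero, mul_one] at hα
      rw [hα] at h6
      exact (IsLocalRing.mem_maximalIdeal _).mp h6 α.isUnit
    · exact hpos
  -- `m = n`: compare the two factorisations of `Δ(J')`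
  have hmn : m = n := by
    have hφu : IsUnit (φ u) := (isUnit_map_iff hw hφ u).mpr hu
    have h432 : IsUnit (1 + 432 * J'.a₆) := by
      by_contra hnu
      have hmem : 1 + 432 * J'.a₆ ∈ maximalIdeal _ := (IsLocalRing.mem_maximalIdeal _).mpr hnu
      have h1mem : (1 : Valuation.valuationSubring (Valuation.comap (algebraMap
          (maxUnramified (v.adicCompletion K)) (AlgebraicClosure (v.adicCompletion K))) w)) ∈
          maximalIdeal _ := by
        have := Ideal.sub_mem _ hmem (Ideal.mul_mem_left _ 432 h6)
        rwa [add_sub_cancel_right] at this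
      exact (IsLocalRing.mem_maximalIdeal _).mp h1mem isUnit_one
    have hlhs : J'.Δ = ↑((-1 : (Valuation.valuationSubring (Valuation.comap (algebraMap
        (maxUnramified (v.adicCompletion K)) (AlgebraicClosure (v.adicCompletion K))) w))ˣ) *
        α * h432.unit) * φ π ^ m := by
      rw [J'.Δ_eq_of_tateNormalForm h1 h2 h3 h4]
      conv_lhs => rw [hα]
      simp only [Units.val_mul, Units.val_neg, Units.val_one, IsUnit.unit_spec]
      conv_rhs => rw [show (1 + 432 * J'.a₆) = (1 + 432 * (↑α * φ π ^ m)) by rw [hα]]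
      ring
    have hrhs : J'.Δ = ↑((D.u⁻¹) ^ 12 * hφu.unit) * φ π ^ n := by
      rw [hJ', WeierstrassCurve.variableChange_Δ, hJdef, WeierstrassCurve.map_Δ, hΔ, map_mul,
        map_pow]
      simp only [Units.val_mul, Units.val_pow_eq_pow_val, IsUnit.unit_spec]
      ring
    exact IsDiscreteValuationRing.unit_mul_pow_congr_pow hϖ' hϖ' _ _ m n (hlhs.symm.trans hrhs)
  have key := LocalIndex.index_eq_of_tateNormalForm (K := (maxUnramified (v.adicCompletion K)))
    J' hϖ' h1 h2 h3 h4 α.isUnit hm1 hα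
  rw [hJ', index_nonsingularReductionSubgroup_smul, hmn] at key
  -- so `n • Q ∈ E₀` for every `Q ∈ J(K_v^nr)`
  have hnQ : ∀ Q : (J.baseChange (maxUnramified (v.adicCompletion K))).toAffine.Point,
      J.HasNonsingularReduction (n • Q) := by
    intro Q
    have := (J.nonsingularReductionSubgroup hvR).nsmul_index_mem Q
    rw [key] at this
    exact this
  /- (2) the models `J ⊗ K_v^nr = X ⊗ K_v^nr` and `W₀ = J ⊗ 𝒪_w` with `W₀ ⊗ K̄_v = X ⊗ K̄_v` -/
  have hX₀K : X₀.baseChange (v.adicCompletion K) = X := rfl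
  have hJK : J.baseChange (maxUnramified (v.adicCompletion K)) =
      X.baseChange (maxUnramified (v.adicCompletion K)) := by
    rw [← hX₀K]
    change (X₀.map φ).map (algebraMap _ _) =
      (X₀.map (algebraMap (v.adicCompletionIntegers K) (v.adicCompletion K))).map
        (algebraMap (v.adicCompletion K) (maxUnramified (v.adicCompletion K)))
    rw [WeierstrassCurve.map_map, WeierstrassCurve.map_map]
    congr 1
    refine RingHom.ext fun a ↦ Subtype.ext ?_
    change (((φ a : (Valuation.valuationSubring (Valuation.comap (algebraMap
      (maxUnramified (v.adicCompletion K)) (AlgebraicClosure (v.adicCompletion K))) w))) :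
        (maxUnramified (v.adicCompletion K))) : (AlgebraicClosure (v.adicCompletion K))) =
      ((algebraMap (v.adicCompletion K) (maxUnramified (v.adicCompletion K))
        (algebraMap (v.adicCompletionIntegers K) (v.adicCompletion K) a) :
          (maxUnramified (v.adicCompletion K))) : (AlgebraicClosure (v.adicCompletion K)))
    rw [hφ, IntermediateField.coe_algebraMap_apply]
    rfl
  set W₀ : WeierstrassCurve w.integer := J.map ψ with hW₀def
  have hW₀ : W₀.baseChange (AlgebraicClosure (v.adicCompletion K)) =
      X.baseChange (AlgebraicClosure (v.adicCompletion K)) := by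
    rw [← hX₀K]
    change ((X₀.map φ).map ψ).map (algebraMap _ _) =
      (X₀.map (algebraMap (v.adicCompletionIntegers K) (v.adicCompletion K))).map
        (algebraMap (v.adicCompletion K) (AlgebraicClosure (v.adicCompletion K)))
    rw [WeierstrassCurve.map_map, WeierstrassCurve.map_map, WeierstrassCurve.map_map]
    congr 1
    refine RingHom.ext fun a ↦ ?_
    change ((ψ (φ a) : w.integer) : (AlgebraicClosure (v.adicCompletion K))) =
      algebraMap (v.adicCompletion K) (AlgebraicClosure (v.adicCompletion K))
        (algebraMap (v.adicCompletionIntegers K) (v.adicCompletion K) a)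
    rw [hψ, hφ]
    rfl
  -- the residue field of `𝒪ⁿʳ` embeds into that of `𝒪_w`
  haveI hψloc : IsLocalHom ψ := ⟨fun a ha ↦ by
    by_contra hna
    have hmem : a ∈ maximalIdeal (Valuation.valuationSubring (Valuation.comap (algebraMap
        (maxUnramified (v.adicCompletion K)) (AlgebraicClosure (v.adicCompletion K))) w)) :=
      (IsLocalRing.mem_maximalIdeal _).mpr (mem_nonunits_iff.mpr hna)
    have := (map_mem_maximalIdeal_integer_iff hψ a).mpr hmem
    exact (mem_nonunits_iff.mp ((IsLocalRing.mem_maximalIdeal _).mp this)) ha⟩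
  have hκ : W₀.map (residue w.integer) =
      ((J.map (residue (Valuation.valuationSubring (Valuation.comap (algebraMap
        (maxUnramified (v.adicCompletion K)) (AlgebraicClosure (v.adicCompletion K))) w)))).map
        (IsLocalRing.ResidueField.map ψ)) := by
    rw [hW₀def]
    simp only [WeierstrassCurve.map_map]
    congr 1
  -- the reduction of `W₀` is a node
  have hW₀Δ : IsLocalRing.residue w.integer W₀.Δ = 0 := by
    rw [IsLocalRing.residue_eq_zero_iff, hW₀def, WeierstrassCurve.map_Δ,
      map_mem_maximalIdeal_integer_iff hψ]
    exact hΔI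
  have hW₀c₄ : IsLocalRing.residue w.integer W₀.c₄ ≠ 0 := by
    rw [Ne, IsLocalRing.residue_eq_zero_iff, hW₀def, WeierstrassCurve.map_c₄,
      map_mem_maximalIdeal_integer_iff hψ]
    exact hc₄I
  obtain ⟨r, hr⟩ := W₀.exists_addMonoidHom_units_of_node hv0 hW₀Δ hW₀c₄
  /- (3) the maps on points `J(K_v^nr) ≃ X(K_v^nr) → X(K̄_v)` -/
  set e₁ := WeierstrassCurve.Affine.Point.congrEquiv hJK with he₁
  set ι : (X.baseChange (maxUnramified (v.adicCompletion K))).toAffine.Point →+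
      (X.baseChange (AlgebraicClosure (v.adicCompletion K))).toAffine.Point :=
    WeierstrassCurve.Affine.Point.map (W' := X)
      (IsScalarTower.toAlgHom (v.adicCompletion K) (maxUnramified (v.adicCompletion K))
        (AlgebraicClosure (v.adicCompletion K))) with hι
  have hinjι' : Function.Injective (IsScalarTower.toAlgHom (v.adicCompletion K)
      (maxUnramified (v.adicCompletion K)) (AlgebraicClosure (v.adicCompletion K))) :=
    fun a b hab ↦ Subtype.ext hab
  have hinjι : Function.Injective ι := WeierstrassCurve.Affine.Point.map_injective (W' := X) _
  -- `I_𝔐`-fixed points of `X(K̄_v)` come from `X(K_v^nr)`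
  have hsurj : ∀ P : (X.baseChange (AlgebraicClosure (v.adicCompletion K))).toAffine.Point,
      (∀ σ ∈ 𝔐.inertia (absoluteGaloisGroup (v.adicCompletion K)),
        WeierstrassCurve.Affine.Point.map
          ((absoluteGaloisGroup.toAlgEquiv _ σ : (AlgebraicClosure (v.adicCompletion K))
              ≃ₐ[(v.adicCompletion K)] (AlgebraicClosure (v.adicCompletion K))) :
            (AlgebraicClosure (v.adicCompletion K)) →ₐ[(v.adicCompletion K)]
              (AlgebraicClosure (v.adicCompletion K))) P = P) →
        ∃ Q, ι Q = P := by
    intro P hP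
    rcases P with _ | ⟨x, y, h⟩
    · exact ⟨0, map_zero ι⟩
    · have hx : x ∈ (maxUnramified (v.adicCompletion K)) :=
        (mem_maxUnramified_iff_forall_inertia hw h𝔐).mpr fun σ hσ ↦ by
          have := hP σ hσ
          rw [WeierstrassCurve.Affine.Point.map_some, WeierstrassCurve.Affine.Point.some.injEq] at this
          exact this.1
      have hy : y ∈ (maxUnramified (v.adicCompletion K)) :=
        (mem_maxUnramified_iff_forall_inertia hw h𝔐).mpr fun σ hσ ↦ by
          have := hP σ hσ
          rw [WeierstrassCurve.Affine.Point.map_some, WeierstrassCurve.Affine.Point.some.injEq] at this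
          exact this.2
      have h₀ : (X.baseChange (maxUnramified (v.adicCompletion K))).toAffine.Nonsingular
          ⟨x, hx⟩ ⟨y, hy⟩ :=
        (WeierstrassCurve.Affine.baseChange_nonsingular (W := X)
          (f := IsScalarTower.toAlgHom (v.adicCompletion K) (maxUnramified (v.adicCompletion K))
            (AlgebraicClosure (v.adicCompletion K))) hinjι' ⟨x, hx⟩ ⟨y, hy⟩).mp h
      exact ⟨.some _ _ h₀, rfl⟩
  -- `E₀` of `J` over `𝒪ⁿʳ` maps into `E₀` of `W₀` over `𝒪_w`
  have hE₀ : ∀ Q : (J.baseChange (maxUnramified (v.adicCompletion K))).toAffine.Point,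
      J.HasNonsingularReduction Q →
        W₀.HasNonsingularReduction
          ((WeierstrassCurve.Affine.Point.congrEquiv hW₀).symm (ι (e₁ Q))) := by
    intro Q hQ
    rcases point_cases hvR Q with rfl | ⟨x, y, h, rfl, hx⟩ | ⟨a, b, h, rfl⟩
    · rw [map_zero, map_zero, map_zero]
      exact WeierstrassCurve.hasNonsingularReduction_zero
    · have hx' : 1 < w (x : (AlgebraicClosure (v.adicCompletion K))) := not_le.mp fun hle ↦
        (not_mem_range_iff hvR).mpr hx
          ⟨⟨x, (Valuation.mem_valuationSubring_iff _ _).mpr hle⟩, rfl⟩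
      rw [he₁, WeierstrassCurve.Affine.Point.congrEquiv_some]
      change W₀.HasNonsingularReduction ((WeierstrassCurve.Affine.Point.congrEquiv hW₀).symm
        (WeierstrassCurve.Affine.Point.some _ _ _))
      rw [WeierstrassCurve.Affine.Point.congrEquiv_symm_some]
      refine Or.inl ?_
      rw [not_mem_range_iff hv0]
      exact hx'
    · have hns := (WeierstrassCurve.hasNonsingularReduction_some_algebraMap_iff hinjR h).mp hQ
      rw [he₁, WeierstrassCurve.Affine.Point.congrEquiv_some]
      change W₀.HasNonsingularReduction ((WeierstrassCurve.Affine.Point.congrEquiv hW₀).symm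
        (WeierstrassCurve.Affine.Point.some _ _ _))
      rw [WeierstrassCurve.Affine.Point.congrEquiv_symm_some]
      refine Or.inr ⟨ψ a, ψ b, hψ a, hψ b, ?_⟩
      rw [hκ, ← IsLocalRing.ResidueField.map_residue, ← IsLocalRing.ResidueField.map_residue]
      exact (WeierstrassCurve.Affine.map_nonsingular _
        (IsLocalRing.ResidueField.map ψ).injective _ _).mpr hns
  /- (4) every `p`-torsion point of `X(K̄_v)` has nonsingular reduction on `W₀` -/
  have hG : ∀ P : (X.baseChange (AlgebraicClosure (v.adicCompletion K))).toAffine.Point,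
      p • P = 0 → W₀.HasNonsingularReduction
        ((WeierstrassCurve.Affine.Point.congrEquiv hW₀).symm P) := by
    intro P hP
    obtain ⟨Q₀, rfl⟩ := hsurj P (fun σ hσ ↦ hall σ hσ P hP)
    set Q := e₁.symm Q₀ with hQ
    have hQ₀ : Q₀ = e₁ Q := by rw [hQ, AddEquiv.apply_symm_apply]
    rw [hQ₀] at hP ⊢
    -- `p • Q = 0`
    have hpQ : p • Q = 0 := by
      apply e₁.injective
      apply hinjι
      rw [map_nsmul, map_nsmul, hP, map_zero, map_zero]
    -- `Q ∈ E₀` by Bezout: `1 = n A + p B`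
    have hcop : Nat.Coprime n p := (Nat.coprime_comm.mp ((Nat.Prime.coprime_iff_not_dvd hp).mpr hpn))
    have hbez := Nat.gcd_eq_gcd_ab n p
    rw [Nat.Coprime.gcd_eq_one hcop, Nat.cast_one] at hbez
    have hQE₀ : J.HasNonsingularReduction Q := by
      have hmem : (n.gcdA p) • ((n : ℤ) • Q) + (n.gcdB p) • ((p : ℤ) • Q) ∈
          J.nonsingularReductionSubgroup hvR := by
        refine (J.nonsingularReductionSubgroup hvR).add_mem
          ((J.nonsingularReductionSubgroup hvR).zsmul_mem ?_ _)
          ((J.nonsingularReductionSubgroup hvR).zsmul_mem ?_ _)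
        · rw [natCast_zsmul]; exact hnQ Q
        · rw [natCast_zsmul, hpQ]; exact (J.nonsingularReductionSubgroup hvR).zero_mem
      have hEq : (n.gcdA p) • ((n : ℤ) • Q) + (n.gcdB p) • ((p : ℤ) • Q) = Q := by
        rw [smul_smul, smul_smul, ← add_smul, mul_comm (n.gcdA p), mul_comm (n.gcdB p), ← hbez,
          one_smul]
      rw [hEq] at hmem
      exact hmem
    exact hE₀ Q hQE₀
  /- (5) counting: the node map embeds the `p`-torsion into the `p`-th roots of unity -/
  set G := WeierstrassCurve.torsionPoints X (AlgebraicClosure (v.adicCompletion K)) p with hGdef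
  have hcardG : Nat.card G = p ^ 2 :=
    WeierstrassCurve.card_torsionPoints_eq_sq_holds X (AlgebraicClosure (v.adicCompletion K)) hpL
  have hGp : ∀ P : G, p • (P : (X.baseChange (AlgebraicClosure (v.adicCompletion K))).toAffine.Point)
      = 0 := fun P ↦ by
    have := (WeierstrassCurve.mem_torsionPoints_iff X (AlgebraicClosure (v.adicCompletion K))
      (P : (X.baseChange (AlgebraicClosure (v.adicCompletion K))).toAffine.Point)).mp P.2
    rwa [natCast_zsmul] at this
  -- the map `G → \bar k^×`
  set f : G → (AlgebraicClosure (IsLocalRing.ResidueField w.integer))ˣ := fun P ↦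
    Additive.toMul (r ⟨(WeierstrassCurve.Affine.Point.congrEquiv hW₀).symm P, hG _ (hGp P)⟩)
    with hf
  -- its values are `p`-th roots of unity
  haveI : NeZero p := ⟨hp.ne_zero⟩
  have hfmem : ∀ P : G, f P ∈ rootsOfUnity p (AlgebraicClosure (IsLocalRing.ResidueField w.integer)) := by
    intro P
    rw [mem_rootsOfUnity, hf]
    change Additive.toMul (r _) ^ p = 1
    rw [← toMul_nsmul, ← map_nsmul]
    have h0 : p • (⟨(WeierstrassCurve.Affine.Point.congrEquiv hW₀).symm P, hG _ (hGp P)⟩ :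
        W₀.nonsingularReductionSubgroup hv0) = 0 :=
      Subtype.ext (by
        change p • (WeierstrassCurve.Affine.Point.congrEquiv hW₀).symm
          (P : (X.baseChange (AlgebraicClosure (v.adicCompletion K))).toAffine.Point) = 0
        rw [← map_nsmul, hGp P, map_zero])
    rw [h0, map_zero, toMul_zero]
  -- it is injective: the kernel of `r` is `E₁`, which has no `p`-torsion
  have hfinj : Function.Injective f := by
    intro P P' hPP'
    have hsub : r (⟨(WeierstrassCurve.Affine.Point.congrEquiv hW₀).symm P, hG _ (hGp P)⟩ -
        ⟨(WeierstrassCurve.Affine.Point.congrEquiv hW₀).symm P', hG _ (hGp P')⟩) = 0 := by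
      rw [map_sub, sub_eq_zero]
      exact Additive.toMul.injective hPP'
    rw [hr] at hsub
    change W₀.ReducesToZero ((WeierstrassCurve.Affine.Point.congrEquiv hW₀).symm P -
      (WeierstrassCurve.Affine.Point.congrEquiv hW₀).symm P') at hsub
    rw [← map_sub] at hsub
    have htor : (p : ℤ) • (WeierstrassCurve.Affine.Point.congrEquiv hW₀).symm
        ((P : (X.baseChange (AlgebraicClosure (v.adicCompletion K))).toAffine.Point) - P') = 0 := by
      rw [← map_zsmul, smul_sub, natCast_zsmul, natCast_zsmul, hGp P, hGp P', sub_self, map_zero]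
    have h0 := hsub.eq_zero_of_zsmul_eq_zero W₀ hpw htor
    rw [AddEquiv.map_eq_zero_iff (WeierstrassCurve.Affine.Point.congrEquiv hW₀).symm, sub_eq_zero]
      at h0
    exact Subtype.ext h0
  -- `p² = #G ≤ #μ_p ≤ p`
  set f' : G → rootsOfUnity p (AlgebraicClosure (IsLocalRing.ResidueField w.integer)) :=
    fun P ↦ ⟨f P, hfmem P⟩ with hf'
  have hf'inj : Function.Injective f' := fun P P' h ↦ hfinj (congrArg Subtype.val h)
  have hle : Nat.card G ≤ p :=
    (Nat.card_le_card_of_injective f' hf'inj).trans (card_rootsOfUnity _ p)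
  rw [hcardG] at hle
  have : p < p ^ 2 := lt_self_pow₀ hp.one_lt (by norm_num)
  omega

end IsDedekindDomain.HeightOneSpectrum

end
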